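import Summits.QuantumFields.GaugeBoot.DiagonalRPTorusOddCrossing
import Summits.QuantumFields.GaugeBoot.DiagonalRPTorusNegativeTwo
import Literature.MathematicalPhysics.QuantumFieldTheory.LatticeSiteRPMechanism
import HarnessLib

/-!
# Diagonal RP on the ODD two-dimensional torus, V: closed-half diagonal reflection positivity
holds for ALL observables (gauge-boot, task L3(θ))

HONEST FRAMING (cell `pub-gaugeboot`, page 1 of every file): the venture produces certified bounds
on lattice expectations at stated coupling, gauge group, dimension and torus size; NOT a mass gap,
NOT a continuum limit, NOT a string tension; NOT Yang–Mills-summit-bearing (barriers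
`FixedCouplingUltralocality`, `PerturbativeInvisibility`). This module is a small POSITIVE
structural result about which positivity constraints a two-dimensional TORUS certificate may use
(no two-dimensional certificate with a diagonal block exists or is planned; any would need a dated
admission); it discharges nothing else.

## Statements

* **`DiagRPTwo.wilsonExpectation_swap_nonneg_odd`** / **`DiagRPTwo.diagonalReflectionPositive_two_odd`**:
  on the square torus `(ℤ/L)²` with `L` ODD, `L ≥ 3`, Wilson action of a continuous
  finite-dimensional representation `ρ` of a compact metrisable group `G`, `β ≥ 0`, `i ≠ j`:
  `DiagonalReflectionPositive ρ β i j` HOLDS — `0 ≤ ⟨(ΘF)‾ F⟩_{Λ,β}` for EVERY bounded measurable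
  observable `F` of the closed diagonal half `{0 ≤ (y_i - y_j) mod L ≤ c}`, `L = 2c + 1` — this is
  the tree's `IsDiagonalHalfObservable i j F` verbatim, whose bound `L/2` is `c` by ℕ-division for
  odd `L` (no gauge-invariance hypothesis on `F`, no hypothesis on the character).
* **`DiagRPTwo.diagonalReflectionPositive_two_iff_odd_or_zero`** (the `d = 2` classification): for
  `L ≥ 3`, `β ≥ 0` and a non-constant character, `DiagonalReflectionPositive ρ β i j ↔ (Odd L ∨ β = 0)`
  (the even case is `DiagRPTwo.not_diagonalReflectionPositive_two` /
  `diagonalReflectionPositive_zero` of the tree; the `2 × 2` torus fails for every `β`,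
  `not_diagonalReflectionPositive_two_two`). On odd two-tori the diagonal swap is thus a genuine
  reflection positivity — where the axis site/link reflections need `L` even — and the even-`L`
  failure (L3(δ)) is carried entirely by the back LAYER `k = c = -c`, which odd tori do not have.

## Mechanism (`DiagonalRPTorusOddZigzag/Action/Average/Crossing.lean`)

For odd `L` the two closed halves `H = Z_0 ∪ ⋯ ∪ Z_{c-1}` and `θH` share no link, and the swap
maps the MIDDLE ZIGZAG `Z_c` (the `2L` links between the layers `c` and `c + 1 = -c`) onto itself
as the rotation by `L` links — an odd rotation, exchanging the two vertex classes. Pointwise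
`e^{-βS} (ΘF)‾ F = const · g · (g∘Θ)‾ · E₀ · A · (A∘Θ)` (`rpIntegrand_eq_odd`) with `g = F e^{βS_int}`,
`E₀` the mirror crossing weight (a Gram kernel, `sum_ocoeff_mul_conj`) and `A` the layer-`c`
weight, which couples `Z_{c-1} ⊂ H` to `Z_c` through the transports `C_y` only. (1) Average `A`
over the fibrewise vertex action at the layer-`c` vertices of `Z_c` (`integral_oavg_mul`; the
measure, `g`, `g∘Θ`, `E₀`, `A∘Θ` are invariant): `∫ … A (A∘Θ) = ∫ … Ā (A∘Θ)`; (2) the same for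
`A∘Θ` after the substitution `U ↦ ΘU`: `∫ … Ā (Ā∘Θ)`; (3) `Ā` is invariant under every fibrewise
vertex action of `Z_c` and `Θ = zig_{h(U)} ∘ Θ″` with `Θ″` the swap off `Z_c`
(`configDiagSwap_eq_zigM_configOddSwap`), so `Ā∘Θ = Ā∘Θ″` (`layerAvg_configDiagSwap`); (4) `Θ″`
is a measure-preserving involution FIXING `Z_c` and carrying `H` off `H ∪ Z_c`, `G = g Ā` reads
`H ∪ Z_c`, so `0 ≤ ∫ G (G∘Θ″)‾ E₀` by the shared-block abstract RP lemma
`LatticeRP.integral_mul_conj_mul_exp_nonneg_of_shared` (Fröhlich–Israel–Lieb–Simon 1978 Thm. 2.1,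
reflection 'through sites', the middle zigzag as the shared block). `β ≥ 0` enters only through
the Gram form of `E₀`.

NOT claimed: `β < 0`; `d ≥ 3` (there closed-half diagonal RP is false at every `L`,
`not_diagonalReflectionPositive`). Cell references: HOME/pub-gaugeboot-lean3/gen14/L3theta-DESIGN.md
(the conjecture settled here); LOOP-SDP.md §3.4 (loop lane) for the certificate-side reading.
All statements are proved.
-/

open MeasureTheory Complex Finset Function
open scoped ComplexOrder ENNReal

namespace Summit.QuantumFields.GaugeBoot

open Literature.MathematicalPhysics.QuantumFieldTheory

noncomputable section

namespace DiagRPTwo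

section Steps

variable {L N : ℕ} [NeZero L] {G : Type*} [Group G] [TopologicalSpace G] [IsTopologicalGroup G]
  [CompactSpace G] [MeasurableSpace G] [BorelSpace G] [SecondCountableTopology G]
  (ρ : G →* Matrix (Fin N) (Fin N) ℂ) {i j : Fin 2}

omit [NeZero L] [Group G] [TopologicalSpace G] [IsTopologicalGroup G] [CompactSpace G]
  [MeasurableSpace G] [BorelSpace G] [SecondCountableTopology G] in
/-- Norm of a product from bounds on the factors. -/
private theorem norm_mul_le' {a b : ℂ} {A B : ℝ} (ha : ‖a‖ ≤ A) (hb : ‖b‖ ≤ B) :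
    ‖a * b‖ ≤ A * B := by
  rw [norm_mul]; exact mul_le_mul ha hb (norm_nonneg _) ((norm_nonneg _).trans ha)

omit [NeZero L] [Group G] [TopologicalSpace G] [IsTopologicalGroup G] [CompactSpace G] [BorelSpace G]
  [SecondCountableTopology G] in
/-- The swap of configurations is measurable. -/
private theorem measurable_configDiagSwap' :
    Measurable (configDiagSwap (G := G) (L := L) i j) :=
  measurable_pi_lambda _ fun _ => measurable_pi_apply _

/-- **Step 1 — averaging the layer weight over the layer-`c` action**:
`∫ g (g∘Θ)‾ E₀ A (A∘Θ) = ∫ Ā · (g (g∘Θ)‾ E₀ (A∘Θ))` (odd `L ≥ 3`). -/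
theorem integral_rpPhiOdd_eq_step1 (hL : Odd L) (h3 : 3 ≤ L) (hij : i ≠ j) (hρ : Continuous ρ)
    (β : ℝ) {F : GaugeConfig 2 L G → ℂ} (hF : Measurable F) {CF : ℝ} (hFb : ∀ U, ‖F U‖ ≤ CF)
    (hFH : IsDiagonalHalfObservable i j F) :
    ∫ U, rpPhiOdd ρ i j β F U ∂(linkMeasure L G) =
      ∫ U, layerAvg ρ i j β U * (gObs ρ i j β F U *
        (starRingEnd ℂ) (gObs ρ i j β F (configDiagSwap i j U)) * (mirrorE ρ i j β U : ℂ) *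
          (layerW ρ i j β (configDiagSwap i j U) : ℂ)) ∂(linkMeasure L G) := by
  have hg := measurable_gObs ρ i j hρ β hF
  have hΘ := measurable_configDiagSwap' (G := G) (L := L) (i := i) (j := j)
  have key := integral_oavg_mul (i := i) (j := j) (g := fun V => (layerW ρ i j β V : ℂ))
    (Φ := fun U => gObs ρ i j β F U * (starRingEnd ℂ) (gObs ρ i j β F (configDiagSwap i j U)) *
      (mirrorE ρ i j β U : ℂ) * (layerW ρ i j β (configDiagSwap i j U) : ℂ))
    (measurable_layerW ρ hρ β) (norm_layerW_le ρ hρ β)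
    ((((hg.mul (Complex.continuous_conj.measurable.comp (hg.comp hΘ))).mul
      (measurable_mirrorE ρ hρ β)).mul ((measurable_layerW ρ hρ β).comp hΘ)))
    (fun U => norm_mul_le' (norm_mul_le' (norm_mul_le' (norm_gObs_le ρ i j hρ β hFb U)
      (by rw [Complex.norm_conj]; exact norm_gObs_le ρ i j hρ β hFb _)) (norm_mirrorE_le ρ hρ β U))
      (norm_layerW_le ρ hρ β _))
    (fun k U => by
      simp only [gObs_zigM ρ h3 hij β hFH, gObs_configDiagSwap_zigM ρ hL h3 hij β hFH,
        mirrorE_zigM ρ h3 hij, layerW_configDiagSwap_zigM_onB ρ hL h3 hij])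
  unfold layerAvg
  rw [key]
  refine integral_congr_ae (Filter.Eventually.of_forall fun U => ?_)
  simp only [rpPhiOdd]
  ring

/-- **Step 2 — the same for the swapped layer weight**, after the substitution `U ↦ ΘU`:
`∫ Ā · (g (g∘Θ)‾ E₀ (A∘Θ)) = ∫ g (g∘Θ)‾ E₀ Ā (Ā∘Θ)` (odd `L ≥ 3`). -/
theorem integral_step1_eq_step2 (hL : Odd L) (h3 : 3 ≤ L) (hij : i ≠ j) (hρ : Continuous ρ)
    (β : ℝ) {F : GaugeConfig 2 L G → ℂ} (hF : Measurable F) {CF : ℝ} (hFb : ∀ U, ‖F U‖ ≤ CF)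
    (hFH : IsDiagonalHalfObservable i j F) :
    ∫ U, layerAvg ρ i j β U * (gObs ρ i j β F U *
        (starRingEnd ℂ) (gObs ρ i j β F (configDiagSwap i j U)) * (mirrorE ρ i j β U : ℂ) *
          (layerW ρ i j β (configDiagSwap i j U) : ℂ)) ∂(linkMeasure L G) =
      ∫ U, gObs ρ i j β F U * (starRingEnd ℂ) (gObs ρ i j β F (configDiagSwap i j U)) *
        (mirrorE ρ i j β U : ℂ) * layerAvg ρ i j β U * layerAvg ρ i j β (configDiagSwap i j U)
          ∂(linkMeasure L G) := by
  have hg := measurable_gObs ρ i j hρ β hF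
  have hΘ := measurable_configDiagSwap' (G := G) (L := L) (i := i) (j := j)
  -- the onB-invariant cofactor of `A` after the substitution
  set Ψ : GaugeConfig 2 L G → ℂ := fun U => gObs ρ i j β F (configDiagSwap i j U) *
    (starRingEnd ℂ) (gObs ρ i j β F U) * (mirrorE ρ i j β U : ℂ) *
      layerAvg ρ i j β (configDiagSwap i j U) with hΨ
  have h1 : ∫ U, layerAvg ρ i j β U * (gObs ρ i j β F U *
        (starRingEnd ℂ) (gObs ρ i j β F (configDiagSwap i j U)) * (mirrorE ρ i j β U : ℂ) *
          (layerW ρ i j β (configDiagSwap i j U) : ℂ)) ∂(linkMeasure L G) =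
      ∫ U, (layerW ρ i j β U : ℂ) * Ψ U ∂(linkMeasure L G) := by
    rw [← integral_comp_configDiagSwap i j]
    refine integral_congr_ae (Filter.Eventually.of_forall fun U => ?_)
    simp only [hΨ, configDiagSwap_configDiagSwap, mirrorE_configDiagSwap ρ hρ hij]
    ring
  have key := integral_oavg_mul (i := i) (j := j) (g := fun V => (layerW ρ i j β V : ℂ)) (Φ := Ψ)
    (measurable_layerW ρ hρ β) (norm_layerW_le ρ hρ β)
    ((((hg.comp hΘ).mul (Complex.continuous_conj.measurable.comp hg)).mul
      (measurable_mirrorE ρ hρ β)).mul ((measurable_layerAvg ρ hρ β).comp hΘ))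
    (fun U => norm_mul_le' (norm_mul_le' (norm_mul_le' (norm_gObs_le ρ i j hρ β hFb _)
      (by rw [Complex.norm_conj]; exact norm_gObs_le ρ i j hρ β hFb _)) (norm_mirrorE_le ρ hρ β U))
      (norm_layerAvg_le ρ hρ β _))
    (fun k U => by
      simp only [hΨ, gObs_zigM ρ h3 hij β hFH, gObs_configDiagSwap_zigM ρ hL h3 hij β hFH,
        mirrorE_zigM ρ h3 hij, layerAvg_configDiagSwap_zigM_onB ρ hρ hL h3 hij])
  rw [h1, ← key, ← integral_comp_configDiagSwap i j]
  refine integral_congr_ae (Filter.Eventually.of_forall fun U => ?_)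
  simp only [hΨ, layerAvg, configDiagSwap_configDiagSwap, mirrorE_configDiagSwap ρ hρ hij]
  ring

/-- **Step 3 — `Θ` versus `Θ″`**, pointwise:
`g (g∘Θ)‾ E₀ Ā (Ā∘Θ) = (gĀ) ((gĀ)∘Θ″)‾ E₀` (odd `L ≥ 3`; `Ā` is real). -/
theorem step2_integrand_eq (hL : Odd L) (h3 : 3 ≤ L) (hij : i ≠ j) (hρ : Continuous ρ) (β : ℝ)
    {F : GaugeConfig 2 L G → ℂ} (hFH : IsDiagonalHalfObservable i j F) (U : GaugeConfig 2 L G) :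
    gObs ρ i j β F U * (starRingEnd ℂ) (gObs ρ i j β F (configDiagSwap i j U)) *
        (mirrorE ρ i j β U : ℂ) * layerAvg ρ i j β U * layerAvg ρ i j β (configDiagSwap i j U) =
      gObs ρ i j β F U * layerAvg ρ i j β U *
        (starRingEnd ℂ) (gObs ρ i j β F (configOddSwap i j U) * layerAvg ρ i j β (configOddSwap i j U)) *
          (mirrorE ρ i j β U : ℂ) := by
  rw [layerAvg_configDiagSwap ρ hρ hL h3 hij, gObs_configDiagSwap_eq ρ h3 hij β hFH, map_mul,
    conj_layerAvg]
  ring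

/-- **Step 4 — the shared-block Osterwalder–Seiler / FILS inequality for `Θ″`**:
`0 ≤ ∫ (gĀ)(U) conj (gĀ)(Θ″U) E₀(U) dU` (odd `L ≥ 3`, `β ≥ 0`). -/
theorem integral_oddSwap_nonneg (hL : Odd L) (h3 : 3 ≤ L) (hij : i ≠ j) (hρ : Continuous ρ)
    {β : ℝ} (hβ : 0 ≤ β) {F : GaugeConfig 2 L G → ℂ} (hF : Measurable F) {CF : ℝ}
    (hFb : ∀ U, ‖F U‖ ≤ CF) (hFH : IsDiagonalHalfObservable i j F) :
    0 ≤ ∫ U, gObs ρ i j β F U * layerAvg ρ i j β U *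
        (starRingEnd ℂ) (gObs ρ i j β F (configOddSwap i j U) * layerAvg ρ i j β (configOddSwap i j U)) *
          (mirrorE ρ i j β U : ℂ) ∂(linkMeasure L G) := by
  classical
  have hdepG : DependsOn (fun U => gObs ρ i j β F U * layerAvg ρ i j β U)
      ((halfLinks i j ∪ zmLinks (L := L) i j : Finset (Edge 2 L)) : Set (Edge 2 L)) := by
    intro U V hUV
    have h1 : gObs ρ i j β F U = gObs ρ i j β F V := dependsOn_gObs' ρ h3 hij β hFH fun e he =>
      hUV e (by rw [Finset.coe_union]; exact Or.inl he)
    have h2 : layerAvg ρ i j β U = layerAvg ρ i j β V := dependsOn_layerAvg ρ h3 hij β hUV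
    simp only [h1, h2]
  have key := LatticeRP.integral_mul_conj_mul_exp_nonneg_of_shared (haarProbability G)
    (M := zmLinks (L := L) i j) (P := halfLinks (L := L) i j) (C := ∅)
    (Θ := configOddSwap (G := G) i j) (measurePreserving_configOddSwap hL hij)
    (fun U e he => configOddSwap_apply_of_zm U (mem_zmLinks.1 he))
    (fun e he => by
      rw [Finset.union_empty] at he
      have hh : InHalf i j e := mem_halfLinks.1 he
      intro U V hUV
      simp only [configOddSwap_apply_of_not_zm _ (not_zm_of_inHalf h3 hij hh)]
      exact hUV _ (Finset.mem_coe.2 (Finset.mem_compl.2 fun h =>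
        not_inHalf_edgeDiagSwap_odd hL h3 hij hh (mem_halfLinks.1 h))))
    (disjoint_zmLinks_halfLinks h3 hij) (Finset.disjoint_empty_right _)
    (g := fun U => gObs ρ i j β F U * layerAvg ρ i j β U) (a := ocoeff ρ i j hρ β)
    ((measurable_gObs ρ i j hρ β hF).mul (measurable_layerAvg ρ hρ β))
    (fun ι => measurable_ocoeff ρ hρ β ι)
    (fun U => norm_mul_le' (norm_gObs_le ρ i j hρ β hFb U) (norm_layerAvg_le ρ hρ β U))
    (fun ι U => norm_ocoeff_le ρ hρ β ι U)
    (by rw [Finset.union_empty]; exact hdepG)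
    (fun ι => by
      rw [Finset.union_empty]
      intro U V hUV
      exact dependsOn_ocoeff ρ h3 hij hρ β ι fun e he => hUV e (by rw [Finset.coe_union]; exact Or.inl he))
  have hsp : ∀ p : GaugeConfig 2 L G × GaugeConfig 2 L G, LatticeRP.splice ∅ p = p.1 := fun p => by
    rw [LatticeRP.splice_eq_piecewise, Finset.piecewise_empty]
  simp only [hsp] at key
  rw [integral_fun_fst (fun U : GaugeConfig 2 L G => gObs ρ i j β F U * layerAvg ρ i j β U *
      (starRingEnd ℂ) (gObs ρ i j β F (configOddSwap i j U) * layerAvg ρ i j β (configOddSwap i j U)) *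
      Complex.exp (∑ ι, ocoeff ρ i j hρ β ι U *
        (starRingEnd ℂ) (ocoeff ρ i j hρ β ι (configOddSwap i j U)))),
    probReal_univ, one_smul] at key
  simp only [sum_ocoeff_mul_conj ρ h3 hij hρ hβ, ← Complex.ofReal_exp] at key
  exact key

/-- **The RP integrand of the odd torus has non-negative integral**: `0 ≤ ∫ Φ_odd dU`
(odd `L ≥ 3`, `β ≥ 0`, every bounded measurable closed-half observable `F`). -/
theorem integral_rpPhiOdd_nonneg (hL : Odd L) (h3 : 3 ≤ L) (hij : i ≠ j) (hρ : Continuous ρ)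
    {β : ℝ} (hβ : 0 ≤ β) {F : GaugeConfig 2 L G → ℂ} (hF : Measurable F) {CF : ℝ}
    (hFb : ∀ U, ‖F U‖ ≤ CF) (hFH : IsDiagonalHalfObservable i j F) :
    0 ≤ ∫ U, rpPhiOdd ρ i j β F U ∂(linkMeasure L G) := by
  rw [integral_rpPhiOdd_eq_step1 ρ hL h3 hij hρ β hF hFb hFH,
    integral_step1_eq_step2 ρ hL h3 hij hρ β hF hFb hFH]
  simp_rw [step2_integrand_eq ρ hL h3 hij hρ β hFH]
  exact integral_oddSwap_nonneg ρ hL h3 hij hρ hβ hF hFb hFH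

end Steps

/-! ## The theorems -/

section Main

variable {L N : ℕ} [NeZero L] {G : Type*} [Group G] [TopologicalSpace G] [IsTopologicalGroup G]
  [CompactSpace G] [MeasurableSpace G] [BorelSpace G] [SecondCountableTopology G]
  (ρ : G →* Matrix (Fin N) (Fin N) ℂ)

/-- **L3(θ): diagonal reflection positivity HOLDS on the ODD two-dimensional torus, for all
observables.** Let `L ≥ 3` be odd, `G` a compact metrisable group, `ρ` a continuous
finite-dimensional representation, `β ≥ 0`, `i ≠ j`. Then for every bounded measurable observable
`F` of the closed diagonal half `{0 ≤ (y_i - y_j) mod L ≤ L/2}`,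
`0 ≤ ⟨(ΘF)‾ F⟩_{Λ,β}` (real and non-negative in `Complex.partialOrder`), `Θ` the diagonal swap. -/
theorem wilsonExpectation_swap_nonneg_odd (hL : Odd L) (h3 : 3 ≤ L) (hρ : Continuous ρ) {β : ℝ}
    (hβ : 0 ≤ β) {i j : Fin 2} (hij : i ≠ j) {F : GaugeConfig 2 L G → ℂ} (hF : Measurable F)
    (hFb : ∃ C : ℝ, ∀ U, ‖F U‖ ≤ C) (hFH : IsDiagonalHalfObservable i j F) :
    0 ≤ wilsonExpectation ρ β fun U => (starRingEnd ℂ) (F (configDiagSwap i j U)) * F U := by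
  obtain ⟨CF, hFb⟩ := hFb
  have hdens : Measurable fun U : GaugeConfig 2 L G =>
      ENNReal.ofReal (Real.exp (-β * wilsonAction ρ U)) :=
    ENNReal.measurable_ofReal.comp ((WilsonRP.measurable_wilsonAction ρ hρ).const_mul (-β)).exp
  unfold wilsonExpectation wilsonMeasure
  rw [integral_smul_measure]
  unfold wilsonWeight
  rw [integral_withDensity_eq_integral_toReal_smul hdens (ae_of_all _ fun _ => ENNReal.ofReal_lt_top)]
  simp_rw [ENNReal.toReal_ofReal (Real.exp_nonneg _), Complex.real_smul]
  refine mul_nonneg (Complex.zero_le_real.2 ENNReal.toReal_nonneg) ?_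
  simp_rw [rpIntegrand_eq_odd ρ hL h3 hij hρ β F]
  rw [integral_const_mul]
  exact mul_nonneg (Complex.zero_le_real.2 (Real.exp_pos _).le)
    (integral_rpPhiOdd_nonneg ρ hL h3 hij hρ hβ hF hFb hFH)

/-- **L3(θ), packaged**: `DiagonalReflectionPositive ρ β i j` holds on `(ℤ/L)²`, `L ≥ 3` odd,
`β ≥ 0` — for ALL bounded measurable closed-half observables (contrast the even torus,
`not_diagonalReflectionPositive_two`: false for `β ≠ 0`). -/
theorem diagonalReflectionPositive_two_odd (hL : Odd L) (h3 : 3 ≤ L) (hρ : Continuous ρ) {β : ℝ}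
    (hβ : 0 ≤ β) {i j : Fin 2} (hij : i ≠ j) :
    DiagonalReflectionPositive (d := 2) (L := L) ρ β i j :=
  fun _ hF hFb hFH => wilsonExpectation_swap_nonneg_odd ρ hL h3 hρ hβ hij hF hFb hFH

/-- **The `d = 2` classification of closed-half diagonal RP on the torus** (`L ≥ 3`, `β ≥ 0`,
non-constant character `Re tr ρ`, `G` Hausdorff): `DiagonalReflectionPositive ρ β i j` holds if and
only if `L` is odd or `β = 0`. (`L = 2`: false for every `β`, `not_diagonalReflectionPositive_two_two`;
`L = 1` is degenerate and not covered.) -/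
theorem diagonalReflectionPositive_two_iff_odd_or_zero [T2Space G] (h3 : 3 ≤ L) (hρ : Continuous ρ)
    (hρN : ∃ g, ((ρ g).trace).re ≠ N) {β : ℝ} (hβ : 0 ≤ β) {i j : Fin 2} (hij : i ≠ j) :
    DiagonalReflectionPositive (d := 2) (L := L) ρ β i j ↔ (Odd L ∨ β = 0) := by
  constructor
  · intro hRP
    by_contra h
    rw [not_or] at h
    have hE : Even L := Nat.not_odd_iff_even.1 h.1
    have h4 : 4 ≤ L := by obtain ⟨r, hr⟩ := hE; omega
    exact not_diagonalReflectionPositive_two ρ hE h4 hρ hρN h.2 hij hRP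
  · rintro (hO | hβ0)
    · exact diagonalReflectionPositive_two_odd ρ hO h3 hρ hβ hij
    · subst hβ0
      rcases Nat.even_or_odd L with hE | hO
      · exact diagonalReflectionPositive_zero ρ hE (by obtain ⟨r, hr⟩ := hE; omega) hij
      · exact diagonalReflectionPositive_two_odd ρ hO h3 hρ le_rfl hij

/-- **Gauge-invariant diagonal RP on odd two-tori**: `GaugeInvariantDiagonalRP ρ β i j` (L3(ε)/(ζ))
holds on `(ℤ/L)²` for every odd `L ≥ 3` and `β ≥ 0` (on even tori it needs `L ≥ 4`,
`gaugeInvariantDiagonalRP_two_iff_four_le`); likewise `BackInvariantDiagonalRP` (L3(η)) via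
`DiagonalReflectionPositive.backInvariantDiagonalRP` of `DiagonalRPTorusInnerHalf.lean`. -/
theorem gaugeInvariantDiagonalRP_two_odd (hL : Odd L) (h3 : 3 ≤ L) (hρ : Continuous ρ) {β : ℝ}
    (hβ : 0 ≤ β) {i j : Fin 2} (hij : i ≠ j) :
    GaugeInvariantDiagonalRP (d := 2) (L := L) ρ β i j :=
  (diagonalReflectionPositive_two_odd ρ hL h3 hρ hβ hij).gaugeInvariantDiagonalRP

end Main

end DiagRPTwo

end

end Summit.QuantumFields.GaugeBoot
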